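import Literature.Probability.LatticeModels.DobrushinMetricStates
import HarnessLib

/-!
# From total-variation bounds on far marginals to a one-boundary-site Lipschitz influence array
# (shell telescoping; the dual form of a disagreement coupling)

Topic `Literature/Probability/LatticeModels`; theorems only (no definitions, no named facts).

The Dobrushin–Shlosman window comparison in the Vasserstein / Kantorovich–Rubinstein form
(`DobrushinShlosmanContraction.lean`, `DobrushinShlosmanUniqueness.lean`) consumes the one-boundary-site
window contraction hypothesis (H1): for two boundary conditions `ω, η` differing at ONE site `y` and a
window-local observable `f` with site-Lipschitz vector `δ`,
`|γ_W f(ω) − γ_W f(η)| ≤ Σ_{x ∈ W} K(y,x) δ x`. Finite-volume MIXING hypotheses of the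
Dobrushin–Shlosman / Martinelli–Olivieri type (e.g. Chatterjee 2021, Def. 2.3 via his Cor. 7.6) deliver
instead TOTAL-VARIATION bounds on the marginals of the two window kernels far from `y`:
`|∫ h dμ − ∫ h dν| ≤ ε_j` for every `[−1,1]`-valued `h` reading only the sites of `W` at "distance"
`φ ≥ j` from `y`. This file converts the latter into the former with the DECAYING array
`K(y,x) = ε_{φ(x)}` (`abs_integral_sub_integral_le_sum_shells`), by telescoping `f` over the distance
shells: freezing the sites of `W` with `φ < j` to a reference configuration gives `A_j f`, reading only
`{φ ≥ j}`; `A_0 f = f`, `A_J f` is constant for `J > max φ`, and `|A_j f − A_{j+1} f| ≤ Σ_{φ(x) = j} δ x`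
pointwise (interpolation one site at a time), so that
`|μ f − ν f| ≤ Σ_j ε_j Σ_{φ(x)=j} δ x = Σ_{x ∈ W} ε_{φ(x)} δ x`.
This is the dual (observable) form of the standard disagreement-coupling estimate
`|μ f − ν f| ≤ Σ_x P(σ_x ≠ σ'_x) δ x` and needs no coupling.

References: R. L. Dobrushin, S. B. Shlosman (1985), Thm. 1 (condition `C_V`); F. Martinelli,
*Lectures on Glauber dynamics for discrete spin models*, LNM 1717 (1999), §2.3 (finite-volume mixing
conditions); H. Föllmer, LNM 1362 (1988) Ch. I Remark (2.17) (interpolation bound); S. Chatterjee,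
CMP 385 (2021), Cor. 7.6 / Lemma 8.1 (the coupling this replaces).
-/

noncomputable section

open MeasureTheory Finset Function

namespace Literature.Probability.LatticeModels.DobrushinShlosman

variable {V S : Type*} [MeasurableSpace S]

/-- Freezing the sites of a finite set to a reference configuration is measurable. [folklore] -/
private theorem measurable_piecewise_ref [DecidableEq V] (s : Finset V) (τ₀ : V → S) :
    Measurable fun σ : V → S => s.piecewise τ₀ σ := by
  refine measurable_pi_lambda _ fun v => ?_
  by_cases hv : v ∈ s
  · simp only [Finset.piecewise_eq_of_mem _ _ _ hv]; exact measurable_const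
  · simp only [Finset.piecewise_eq_of_notMem _ _ _ hv]; exact measurable_pi_apply v

omit [MeasurableSpace S] in
/-- **Interpolation over a finite set of sites** (Föllmer 1988 Ch. I Remark (2.17)): if
`|f σ − f τ| ≤ δ x` whenever `σ = τ` off the site `x`, then freezing the sites of `s` to `τ₀` changes `f`
by at most `Σ_{x ∈ s} δ x`. [cite: Follmer1988, Ch. I Remark (2.17)] -/
theorem abs_sub_piecewise_le_sum [DecidableEq V] {f : (V → S) → ℝ} {δ : V → ℝ}
    (hδ : ∀ (x : V) (σ τ : V → S), (∀ v, v ≠ x → σ v = τ v) → |f σ - f τ| ≤ δ x)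
    (s : Finset V) (τ₀ σ : V → S) : |f σ - f (s.piecewise τ₀ σ)| ≤ ∑ x ∈ s, δ x := by
  -- adapted from `DobrushinMetric.abs_sub_le_sum_of_dependsOn`
  induction s using Finset.induction_on with
  | empty => simp
  | insert y s hy ih =>
    rw [Finset.sum_insert hy]
    have hstep : |f (s.piecewise τ₀ σ) - f ((insert y s).piecewise τ₀ σ)| ≤ δ y :=
      hδ y _ _ fun z hz => by rw [Finset.piecewise_insert_of_ne _ _ _ hz]
    calc |f σ - f ((insert y s).piecewise τ₀ σ)|
        ≤ |f σ - f (s.piecewise τ₀ σ)| + |f (s.piecewise τ₀ σ) - f ((insert y s).piecewise τ₀ σ)| :=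
          abs_sub_le _ _ _
      _ ≤ (∑ x ∈ s, δ x) + δ y := add_le_add ih hstep
      _ = δ y + ∑ x ∈ s, δ x := add_comm _ _

/-- Two averages of a `[−1,1]`-valued measurable function under probability measures differ by at most `2`
(the trivial total-variation bound, usable as `ε_j = 2` on the near shells). [folklore] -/
private theorem abs_integral_sub_integral_le_two {μ ν : Measure (V → S)} [IsProbabilityMeasure μ]
    [IsProbabilityMeasure ν] {h : (V → S) → ℝ} (h1 : ∀ σ, |h σ| ≤ 1) :
    |(∫ σ, h σ ∂μ) - ∫ σ, h σ ∂ν| ≤ 2 := by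
  have hμ : |∫ σ, h σ ∂μ| ≤ 1 := by
    have := norm_integral_le_of_norm_le_const (μ := μ) (f := h) (C := 1)
      (ae_of_all _ fun σ => by rw [Real.norm_eq_abs]; exact h1 σ)
    simpa using this
  have hν : |∫ σ, h σ ∂ν| ≤ 1 := by
    have := norm_integral_le_of_norm_le_const (μ := ν) (f := h) (C := 1)
      (ae_of_all _ fun σ => by rw [Real.norm_eq_abs]; exact h1 σ)
    simpa using this
  calc |(∫ σ, h σ ∂μ) - ∫ σ, h σ ∂ν| ≤ |∫ σ, h σ ∂μ| + |∫ σ, h σ ∂ν| := abs_sub _ _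
    _ ≤ 1 + 1 := add_le_add hμ hν
    _ = 2 := by norm_num

/-- **Shell telescoping: total-variation bounds on the far marginals give a decaying one-boundary-site
Lipschitz influence array** (the dual form of the disagreement-coupling estimate behind
Dobrushin–Shlosman's condition `C_V` and Chatterjee 2021 Lemma 8.1). Let `μ, ν` be probability measures on
`V → S`, `W` a finite set of sites graded by `φ : V → ℕ`, and suppose that for every level `j` and every
measurable `h` with `|h| ≤ 1` reading only the sites `x ∈ W` with `j ≤ φ x`,
`|∫ h dμ − ∫ h dν| ≤ ε j`. Then every bounded measurable `f` reading only `W`, with `|f σ − f τ| ≤ δ x`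
whenever `σ = τ` off `x` (`δ ≥ 0`), satisfies `|∫ f dμ − ∫ f dν| ≤ Σ_{x ∈ W} ε (φ x) · δ x`.
Proof: `A_j f := f ∘ (freeze {x ∈ W | φ x < j} to τ₀)` reads only `{φ ≥ j}`, `A_0 f = f`, `A_J f` is
constant for `J > max_W φ`, and `|A_j f − A_{j+1} f| ≤ Σ_{φ x = j} δ x`; telescope.
[cite: DobrushinShlosman1985, Theorem 1] -/
theorem abs_integral_sub_integral_le_sum_shells [DecidableEq V] {μ ν : Measure (V → S)}
    [IsProbabilityMeasure μ] [IsProbabilityMeasure ν] (W : Finset V) (φ : V → ℕ) (ε : ℕ → ℝ)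
    (hfar : ∀ (j : ℕ) (h : (V → S) → ℝ), Measurable h → (∀ σ, |h σ| ≤ 1) →
      DependsOn h {x | x ∈ W ∧ j ≤ φ x} → |(∫ σ, h σ ∂μ) - ∫ σ, h σ ∂ν| ≤ ε j)
    {f : (V → S) → ℝ} (hfm : Measurable f) {B : ℝ} (hfB : ∀ σ, |f σ| ≤ B)
    (hfdep : DependsOn f (W : Set V)) {δ : V → ℝ} (hδ0 : ∀ x, 0 ≤ δ x)
    (hδ : ∀ (x : V) (σ τ : V → S), (∀ v, v ≠ x → σ v = τ v) → |f σ - f τ| ≤ δ x) :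
    |(∫ σ, f σ ∂μ) - ∫ σ, f σ ∂ν| ≤ ∑ x ∈ W, ε (φ x) * δ x := by
  -- a reference configuration
  obtain ⟨τ₀, -⟩ := nonempty_of_measure_ne_zero (μ := μ) (s := Set.univ) (by simp)
  -- the freezing maps and the averaged observables
  set near : ℕ → Finset V := fun j => W.filter fun x => φ x < j with hnear
  set A : ℕ → (V → S) → ℝ := fun j σ => f ((near j).piecewise τ₀ σ) with hA
  have hAm : ∀ j, Measurable (A j) := fun j => hfm.comp (measurable_piecewise_ref _ τ₀)
  have hAB : ∀ j σ, |A j σ| ≤ B := fun j σ => hfB _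
  -- `A_j f` reads only the sites of `W` of level `≥ j`
  have hAdep : ∀ j, DependsOn (A j) {x | x ∈ W ∧ j ≤ φ x} := by
    intro j σ σ' hσ
    simp only [hA]
    refine hfdep fun v hv => ?_
    have hvW : v ∈ W := Finset.mem_coe.1 hv
    by_cases hvj : φ v < j
    · have hvn : v ∈ near j := Finset.mem_filter.2 ⟨hvW, hvj⟩
      rw [Finset.piecewise_eq_of_mem _ _ _ hvn, Finset.piecewise_eq_of_mem _ _ _ hvn]
    · have hvn : v ∉ near j := fun h => hvj (Finset.mem_filter.1 h).2
      rw [Finset.piecewise_eq_of_notMem _ _ _ hvn, Finset.piecewise_eq_of_notMem _ _ _ hvn]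
      exact hσ v ⟨hvW, not_lt.1 hvj⟩
  -- `A_0 f = f`
  have hA0 : A 0 = f := by
    funext σ
    simp only [hA]
    have : near 0 = ∅ := by
      ext x; simp [hnear]
    rw [this, Finset.piecewise_empty]
  -- `A_J f` is constant for `J` above every level of `W`
  set J : ℕ := W.sup φ + 1 with hJ
  have hφJ : ∀ x ∈ W, φ x < J := fun x hx => Nat.lt_succ_of_le (Finset.le_sup hx)
  have hAJ : ∀ σ, A J σ = f (W.piecewise τ₀ τ₀) := by
    intro σ
    simp only [hA]
    refine hfdep fun v hv => ?_
    have hvW : v ∈ W := Finset.mem_coe.1 hv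
    have hvn : v ∈ near J := Finset.mem_filter.2 ⟨hvW, hφJ v hvW⟩
    rw [Finset.piecewise_eq_of_mem _ _ _ hvn, Finset.piecewise_eq_of_mem _ _ _ hvW]
  -- one shell: `|A_j f − A_{j+1} f| ≤ Σ_{φ x = j} δ x`
  set D : ℕ → ℝ := fun j => ∑ x ∈ W.filter (fun x => φ x = j), δ x with hD
  have hD0 : ∀ j, 0 ≤ D j := fun j => Finset.sum_nonneg fun x _ => hδ0 x
  have hshell : ∀ j σ, |A j σ - A (j + 1) σ| ≤ D j := by
    intro j σ
    set sh : Finset V := W.filter (fun x => φ x = j) with hsh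
    have hmem_sh : ∀ v, v ∈ sh ↔ v ∈ W ∧ φ v = j := fun v => by rw [hsh, Finset.mem_filter]
    have hmem_near : ∀ i v, v ∈ near i ↔ v ∈ W ∧ φ v < i := fun i v => by
      simp only [hnear, Finset.mem_filter]
    simp only [hA, hD]
    -- `near (j+1)`-freezing = `near j`-freezing followed by freezing the shell
    have hpw : (near (j + 1)).piecewise τ₀ σ = sh.piecewise τ₀ ((near j).piecewise τ₀ σ) := by
      funext v
      by_cases hv1 : v ∈ near (j + 1)
      · rw [Finset.piecewise_eq_of_mem _ _ _ hv1]
        obtain ⟨hvW, hvj⟩ := (hmem_near _ v).1 hv1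
        by_cases hvj' : φ v = j
        · rw [Finset.piecewise_eq_of_mem sh _ _ ((hmem_sh v).2 ⟨hvW, hvj'⟩)]
        · have hvn : v ∈ near j := (hmem_near j v).2 ⟨hvW, by omega⟩
          have hvs : v ∉ sh := fun h => hvj' ((hmem_sh v).1 h).2
          rw [Finset.piecewise_eq_of_notMem sh _ _ hvs, Finset.piecewise_eq_of_mem _ _ _ hvn]
      · rw [Finset.piecewise_eq_of_notMem _ _ _ hv1]
        have hvs : v ∉ sh := fun h => by
          obtain ⟨hvW, hvj⟩ := (hmem_sh v).1 h
          exact hv1 ((hmem_near _ v).2 ⟨hvW, by omega⟩)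
        have hvn : v ∉ near j := fun h => by
          obtain ⟨hvW, hvj⟩ := (hmem_near j v).1 h
          exact hv1 ((hmem_near _ v).2 ⟨hvW, by omega⟩)
        rw [Finset.piecewise_eq_of_notMem sh _ _ hvs, Finset.piecewise_eq_of_notMem _ _ _ hvn]
    rw [hpw]
    exact abs_sub_piecewise_le_sum hδ sh τ₀ _
  -- one shell, integrated: `|μ(A_j − A_{j+1}) − ν(A_j − A_{j+1})| ≤ ε_j D_j`
  have hterm : ∀ j, |((∫ σ, A j σ ∂μ) - ∫ σ, A (j + 1) σ ∂μ) -
      ((∫ σ, A j σ ∂ν) - ∫ σ, A (j + 1) σ ∂ν)| ≤ ε j * D j := by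
    intro j
    have hiμ : ∀ i, Integrable (A i) μ := fun i =>
      DobrushinMetric.integrable_of_abs_le' (hAm i) (hAB i)
    have hiν : ∀ i, Integrable (A i) ν := fun i =>
      DobrushinMetric.integrable_of_abs_le' (hAm i) (hAB i)
    rw [← integral_sub (hiμ j) (hiμ (j + 1)), ← integral_sub (hiν j) (hiν (j + 1))]
    rcases (hD0 j).eq_or_lt with hDz | hDpos
    · -- empty shell: the increment vanishes identically
      have hzero : ∀ σ, A j σ - A (j + 1) σ = 0 := fun σ => by
        have := hshell j σ; rw [← hDz] at this; exact abs_nonpos_iff.1 this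
      simp only [hzero, integral_zero, sub_self, abs_zero, ← hDz, mul_zero, le_refl]
    · -- normalise the increment to a `[−1,1]`-valued function reading only `{φ ≥ j}`
      set g : (V → S) → ℝ := fun σ => (A j σ - A (j + 1) σ) / D j with hg
      have hgm : Measurable g := ((hAm j).sub (hAm (j + 1))).div_const _
      have hg1 : ∀ σ, |g σ| ≤ 1 := fun σ => by
        rw [hg, abs_div, abs_of_pos hDpos, div_le_one hDpos]
        exact hshell j σ
      have hgdep : DependsOn g {x | x ∈ W ∧ j ≤ φ x} := by
        intro σ σ' hσ
        simp only [hg]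
        rw [hAdep j hσ, hAdep (j + 1) fun v hv => hσ v ⟨hv.1, by have := hv.2; omega⟩]
      have hfg : ∀ σ, A j σ - A (j + 1) σ = D j * g σ := fun σ => by
        simp only [hg]; field_simp
      simp_rw [hfg, integral_const_mul]
      rw [← mul_sub, abs_mul, abs_of_pos hDpos, mul_comm]
      exact mul_le_mul_of_nonneg_right (hfar j g hgm hg1 hgdep) hDpos.le
  -- telescope
  have htel : (∫ σ, f σ ∂μ) - ∫ σ, f σ ∂ν =
      ∑ j ∈ Finset.range J, (((∫ σ, A j σ ∂μ) - ∫ σ, A (j + 1) σ ∂μ) -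
        ((∫ σ, A j σ ∂ν) - ∫ σ, A (j + 1) σ ∂ν)) := by
    rw [Finset.sum_sub_distrib, Finset.sum_range_sub', Finset.sum_range_sub', hA0]
    simp only [hAJ, integral_const, smul_eq_mul, probReal_univ, one_mul]
    ring
  rw [htel]
  calc |∑ j ∈ Finset.range J, (((∫ σ, A j σ ∂μ) - ∫ σ, A (j + 1) σ ∂μ) -
        ((∫ σ, A j σ ∂ν) - ∫ σ, A (j + 1) σ ∂ν))|
      ≤ ∑ j ∈ Finset.range J, |((∫ σ, A j σ ∂μ) - ∫ σ, A (j + 1) σ ∂μ) -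
        ((∫ σ, A j σ ∂ν) - ∫ σ, A (j + 1) σ ∂ν)| := Finset.abs_sum_le_sum_abs _ _
    _ ≤ ∑ j ∈ Finset.range J, ε j * D j := Finset.sum_le_sum fun j _ => hterm j
    _ = ∑ j ∈ Finset.range J, ∑ x ∈ W.filter (fun x => φ x = j), ε (φ x) * δ x := by
        refine Finset.sum_congr rfl fun j _ => ?_
        rw [hD, Finset.mul_sum]
        exact Finset.sum_congr rfl fun x hx => by rw [(Finset.mem_filter.1 hx).2]
    _ = ∑ x ∈ W, ε (φ x) * δ x :=
        Finset.sum_fiberwise_of_maps_to (fun x hx => Finset.mem_range.2 (hφJ x hx)) _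

end Literature.Probability.LatticeModels.DobrushinShlosman

end
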